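import Mathlib
import Summits.ValiantsHypothesis.ValiantsHypothesis.Theorems.BarrierLeverPartitionMinorsHitByVPHiddenStatesCutGame

/-!
# Route BarrierLever — item `PartitionMinorsHitByVP` (stmt-ValiantsHypothesis-19717), line `hidden_states`:
# THE SHARP LINK BOUND FOR THE CUT GAME — `r` distinct sets are at least as big, in total, as the `r` smallest subsets

Helper file (`--supports stmt-ValiantsHypothesis-19717`; cell valiant-natproofs, rung V4, 𝒟-side door (c), line
`Cruxes/PartitionMinorsHitByVP/Lines/hidden_states.lean` v8; prover seat val-np-p3 gen 13). Definition-free. Closes NO item.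

THE POINT. The u-oblivious cut game (`SymbJoin.symGood_of_winning`, p647050) lets the COLUMN player assume the demanded link size is at
least `lam hd r` for any certified bound `lam`; p647050 certifies the crude `⌈(r−1)/hd⌉`. The sharp averaging bound used by the seat's
lab (memo val-np-p3 g13 §1) is LAYER-CAKE: an injective family of `r` subsets of an `n`-set has total size
`Σ_i |u i| ≥ S(n, r) := Σ_{d<n} (r − Σ_{j≤d} C(n,j))⁺` (`sum_card_ge_layerCake`: at most `Σ_{j≤d} C(n,j)` members have `≤ d` elements, so at
least `r − Σ_{j≤d} C(n,j)` have more than `d`, for every `d`), `S` is antitone in the number of coordinates (`layerCake_mono`), and hence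
(`exists_link_ge_layerCake`) some coordinate has link size `≥ ⌈S(hd, r)/hd⌉` — for a ball `B_t([hd])` this is `≈ t·r/hd` instead of `r/hd`,
and near the full cube it forces halving. `exists_table_of_winning_layerCake` is the cut game with this demand range.

WHAT THIS IS NOT: no winning predicate is exhibited; item 19717 stays OPEN; nothing on crux 14610 or VP ≠ VNP.
-/

set_option linter.dupNamespace false

namespace Summit.ValiantsHypothesis.ValiantsHypothesis.Theorems.BarrierLever.HiddenStates

open Finset Matrix MvPolynomial

noncomputable section

namespace SymbJoin

variable {h m K r : ℕ}

/-! Throughout, the LAYER-CAKE BOUND with `n` coordinates and `r` rows is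
`∑ d ∈ Finset.range n, (r - ∑ j ∈ Finset.range (d + 1), n.choose j)` (truncated subtraction), written out in full. -/

/-- At most `Σ_{j≤d} C(|C|, j)` members of an injective family of subsets of `C` have at most `d` elements. -/
theorem card_filter_card_le (u : Fin r → Finset (Fin h)) (hu : Function.Injective u) (C : Finset (Fin h))
    (hC : ∀ i, u i ⊆ C) (d : ℕ) :
    (Finset.univ.filter fun i => (u i).card ≤ d).card ≤ ∑ j ∈ Finset.range (d + 1), C.card.choose j := by
  classical
  calc (Finset.univ.filter fun i => (u i).card ≤ d).card
      ≤ ((Finset.range (d + 1)).biUnion fun j => C.powersetCard j).card := by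
        refine Finset.card_le_card_of_injOn u (fun i hi => ?_) fun i _ j _ hij => hu hij
        rw [Finset.mem_coe, Finset.mem_filter] at hi
        rw [Finset.mem_coe, Finset.mem_biUnion]
        exact ⟨(u i).card, Finset.mem_range.mpr (Nat.lt_succ_of_le hi.2), Finset.mem_powersetCard.mpr ⟨hC i, rfl⟩⟩
    _ ≤ ∑ j ∈ Finset.range (d + 1), (C.powersetCard j).card := Finset.card_biUnion_le
    _ = ∑ j ∈ Finset.range (d + 1), C.card.choose j := by simp_rw [Finset.card_powersetCard]

/-- **Layer cake.** An injective family of `r` subsets of `C` has total size at least `Σ_{d<|C|} (r − Σ_{j≤d} C(|C|, j))⁺`. -/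
theorem sum_card_ge_layerCake (u : Fin r → Finset (Fin h)) (hu : Function.Injective u) (C : Finset (Fin h))
    (hC : ∀ i, u i ⊆ C) :
    ∑ d ∈ Finset.range C.card, (r - ∑ j ∈ Finset.range (d + 1), C.card.choose j) ≤ ∑ i : Fin r, (u i).card := by
  classical
  -- |u i| = #{d < |C| : d < |u i|}
  have hcake : ∀ i : Fin r, (u i).card = ∑ d ∈ Finset.range C.card, if d < (u i).card then 1 else 0 := by
    intro i
    rw [← Finset.card_filter]
    have : (Finset.range C.card).filter (fun d => d < (u i).card) = Finset.range (u i).card := by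
      ext d
      simp only [Finset.mem_filter, Finset.mem_range]
      constructor
      · exact fun hd => hd.2
      · exact fun hd => ⟨lt_of_lt_of_le hd (Finset.card_le_card (hC i)), hd⟩
    rw [this, Finset.card_range]
  rw [Finset.sum_congr rfl fun i _ => hcake i, Finset.sum_comm]
  refine Finset.sum_le_sum fun d _ => ?_
  rw [← Finset.card_filter]
  -- #{i : d < |u i|} = r − #{i : |u i| ≤ d} ≥ r − Σ_{j≤d} C(|C|, j)
  have hsplit := Finset.card_filter_add_card_filter_not (s := (Finset.univ : Finset (Fin r))) (fun i => d < (u i).card)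
  simp only [not_lt, Finset.card_univ, Fintype.card_fin] at hsplit
  have hle := card_filter_card_le u hu C hC d
  omega

/-- **Monotonicity in the number of coordinates.** With `r ≤ 2^n` rows, the layer-cake bound for `hd ≥ n` coordinates is at most the
one for `n` coordinates (the extra layers are empty and every binomial sum grows). -/
theorem layerCake_mono {n hd : ℕ} (hn : n ≤ hd) (hr : r ≤ 2 ^ n) :
    ∑ d ∈ Finset.range hd, (r - ∑ j ∈ Finset.range (d + 1), hd.choose j)
      ≤ ∑ d ∈ Finset.range n, (r - ∑ j ∈ Finset.range (d + 1), n.choose j) := by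
  have hsub : Finset.range n ⊆ Finset.range hd := Finset.range_subset_range.mpr hn
  rw [← Finset.sum_sdiff hsub]
  -- the layers d ≥ n vanish: Σ_{j≤d} C(hd, j) ≥ Σ_{j≤n} C(n, j) = 2^n ≥ r
  have hzero : ∑ d ∈ Finset.range hd \ Finset.range n, (r - ∑ j ∈ Finset.range (d + 1), hd.choose j) = 0 := by
    refine Finset.sum_eq_zero fun d hd' => ?_
    rw [Finset.mem_sdiff, Finset.mem_range, Finset.mem_range, not_lt] at hd'
    apply Nat.sub_eq_zero_of_le
    calc r ≤ 2 ^ n := hr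
      _ = ∑ j ∈ Finset.range (n + 1), n.choose j := (Nat.sum_range_choose n).symm
      _ ≤ ∑ j ∈ Finset.range (n + 1), hd.choose j := Finset.sum_le_sum fun j _ => Nat.choose_le_choose j hn
      _ ≤ ∑ j ∈ Finset.range (d + 1), hd.choose j :=
          Finset.sum_le_sum_of_subset_of_nonneg (Finset.range_subset_range.mpr (by omega)) fun _ _ _ => Nat.zero_le _
  rw [hzero, zero_add]
  refine Finset.sum_le_sum fun d _ => Nat.sub_le_sub_left ?_ r
  exact Finset.sum_le_sum fun j _ => Nat.choose_le_choose j hn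

/-- **The sharp link bound.** An injective family of `r ≥ 2` subsets of a coordinate set of size `≤ hd` has a coordinate lying in at
least `⌈S(hd, r)/hd⌉` members, `S` the layer-cake bound. -/
theorem exists_link_ge_layerCake (hd : ℕ) (u : Fin r → Finset (Fin h)) (C : Finset (Fin h)) (hCd : C.card ≤ hd)
    (hu : Function.Injective u) (hC : ∀ i, u i ⊆ C) (hr : 2 ≤ r) :
    ∃ x ∈ C, (∑ d ∈ Finset.range hd, (r - ∑ j ∈ Finset.range (d + 1), hd.choose j) + hd - 1) / hd
      ≤ (Finset.univ.filter fun i => x ∈ u i).card := by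
  classical
  set S := ∑ d ∈ Finset.range hd, (r - ∑ j ∈ Finset.range (d + 1), hd.choose j) with hS
  -- r ≤ 2^|C|
  have hr2 : r ≤ 2 ^ C.card := by
    have := Finset.card_le_card_of_injOn u (fun i _ => Finset.mem_coe.mpr (Finset.mem_powerset.mpr (hC i)))
      (fun i _ j _ hij => hu hij) (s := (Finset.univ : Finset (Fin r))) (t := C.powerset)
    rwa [Finset.card_univ, Fintype.card_fin, Finset.card_powerset] at this
  have hSle : S ≤ ∑ i : Fin r, (u i).card :=
    (layerCake_mono hCd hr2).trans (sum_card_ge_layerCake u hu C hC)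
  have hsum := sum_linkCard u C hC
  -- C is nonempty (two distinct rows cannot both be empty)
  have hCne : C.Nonempty := by
    rw [Finset.nonempty_iff_ne_empty]
    intro hCe
    have h01 : (⟨0, by omega⟩ : Fin r) ≠ ⟨1, by omega⟩ := by simp
    apply h01
    apply hu
    have h0 : u ⟨0, by omega⟩ = ∅ := Finset.subset_empty.mp (hCe ▸ hC _)
    have h1 : u ⟨1, by omega⟩ = ∅ := Finset.subset_empty.mp (hCe ▸ hC _)
    rw [h0, h1]
  have hdpos : 0 < hd := lt_of_lt_of_le (Finset.card_pos.mpr hCne) hCd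
  by_contra hno
  push Not at hno
  -- every link is ≤ ⌈S/hd⌉ − 1, so the sum is ≤ hd (⌈S/hd⌉ − 1) < S
  have hle : ∑ x ∈ C, (Finset.univ.filter fun i => x ∈ u i).card ≤ C.card * ((S + hd - 1) / hd - 1) := by
    calc ∑ x ∈ C, (Finset.univ.filter fun i => x ∈ u i).card ≤ ∑ x ∈ C, ((S + hd - 1) / hd - 1) :=
          Finset.sum_le_sum fun x hx => Nat.le_sub_one_of_lt (hno x hx)
      _ = C.card * ((S + hd - 1) / hd - 1) := by rw [Finset.sum_const, smul_eq_mul]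
  have hmul : C.card * ((S + hd - 1) / hd - 1) ≤ hd * ((S + hd - 1) / hd - 1) := Nat.mul_le_mul_right _ hCd
  have hq : (S + hd - 1) / hd * hd ≤ S + hd - 1 := Nat.div_mul_le_self _ _
  have hceil : hd * ((S + hd - 1) / hd - 1) + 1 ≤ S ∨ S = 0 := by
    rcases Nat.eq_zero_or_pos S with h0 | hSpos
    · exact Or.inr h0
    · left
      rw [Nat.mul_sub_one, mul_comm]
      omega
  rcases hceil with hlt | hS0
  · omega
  · -- S = 0: the bound is 0, contradiction with `hno` at any x ∈ C
    obtain ⟨x, hx⟩ := hCne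
    have := hno x hx
    have h0 : (S + hd - 1) / hd = 0 := Nat.div_eq_of_lt (by omega)
    rw [h0] at this
    exact Nat.not_lt_zero _ this

/-- **The cut game with the layer-cake demand range**, in the `∃ table` language: as `exists_table_of_winning`, but the column player may
assume `r₁ ≥ ⌈S(hd, r)/hd⌉` (and still `r₁ ≤ r₀ ≤ 2^(hd−1)`). -/
theorem exists_table_of_winning_layerCake (W : (hd : ℕ) → (r : ℕ) → (Fin r → Fin m × Finset (Fin K)) → Prop)
    (hwin : ∀ (hd r : ℕ) (e : Fin r → Fin m × Finset (Fin K)), W hd r e → 2 ≤ r → 1 ≤ hd →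
      ∀ r₀ r₁ : ℕ, r₀ + r₁ = r →
        (∑ d ∈ Finset.range hd, (r - ∑ j ∈ Finset.range (d + 1), hd.choose j) + hd - 1) / hd ≤ r₁ → r₁ ≤ r₀ →
        r₀ ≤ 2 ^ (hd - 1) →
        ∃ (β : Fin m → ℂ) (γ : Fin m → Fin K → ℂ) (g₀ : Fin r₀ → Fin r) (g₁ : Fin r₁ → Fin r),
          Function.Injective (Sum.elim g₀ g₁) ∧ (∀ j, xi e β γ (g₀ j) = 0) ∧ (∀ j, xi e β γ (g₁ j) ≠ 0) ∧
          W (hd - 1) r₀ (fun j => e (g₀ j)) ∧ W (hd - 1) r₁ (fun j => e (g₁ j)))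
    (e : Fin r → Fin m × Finset (Fin K)) (hW : W h r e)
    (u : Fin r → Finset (Fin h)) (hu : Function.Injective u) (hlow : IsLowerSet (Set.range u)) :
    ∃ tx : Fin m → Option (Fin K) → Fin h → ℂ,
      (Matrix.of fun i k : Fin r =>
        ∏ a ∈ u i, (tx (e k).1 none a + ∑ q ∈ (e k).2, tx (e k).1 (some q) a)).det ≠ 0 := by
  refine exists_table_of_symGood u e ?_
  refine symGood_of_winning W
    (fun hd r => (∑ d ∈ Finset.range hd, (r - ∑ j ∈ Finset.range (d + 1), hd.choose j) + hd - 1) / hd)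
    (fun hd r u C hCd hu _ hC hr => exists_link_ge_layerCake hd u C hCd hu hC hr) hwin h r u Finset.univ e ?_ hu hlow
    (fun i => Finset.subset_univ _) hW
  rw [Finset.card_univ, Fintype.card_fin]

end SymbJoin

end

end Summit.ValiantsHypothesis.ValiantsHypothesis.Theorems.BarrierLever.HiddenStates
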